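import Literature.NumberTheory.IwasawaTheory.ImaginaryQuadraticTwoTowerDyadicGrowthLowerBound
import Literature.NumberTheory.IwasawaTheory.ImaginaryQuadraticTwoTowerGenusRank
import Literature.NumberTheory.IwasawaTheory.CyclotomicTwoTowerOddPrimeDecompositionExact
import Mathlib.Data.Set.Card.Arithmetic
import HarnessLib

/-!
# Genus theory in the cyclotomic `ℤ₂`-tower of `ℚ(√−d)`, `d ≡ 1 (mod 4)`: `rank₂ Cl(K_n) = Σ_{ℓ ∣ d} 2^{min(n, ord₂(ℓ²−1)−3)}` (the dyadic prime
# adds one ramified prime), and Ferrero–Kida up to one: `Σ − 1 ≤ λ₂(K) ≤ Σ` (proved; no definition, no named fact)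

Topic `NumberTheory/IwasawaTheory` (namespace = path).  THEOREM-ONLY file, written by the prover seat `bsd-line-att-p3` g32 (cell `bsd-f1-sign2`; `--supports`
stmt-BirchSwinnertonDyer-22298; closes nothing).  Sequel of `ImaginaryQuadraticTwoTowerGenusRank` (g30: odd `d_K`) and `ImaginaryQuadraticTwoTowerDyadicGrowthLowerBound`.

* §1 `natCard_twoTorsion_classGroup_fieldRange_sup_layer_eq_of_sq_eq_neg` — `K ∋ √−d`, `d ≡ 1 (mod 4)` squarefree, `X_n = e(K)·ℚ_n`: the finite primes of `X_n⁺` ramified in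
  `X_n` are the dyadic prime and the primes above the (odd) prime factors of `d`, so **`#Cl(X_n)[2] = 2^{Σ_{ℓ ∣ d} g_n(ℓ)}`** (`g_n(ℓ)` = number of primes of
  `ℚ_n` above `ℓ`; Okazaki's Lemma 17 with `t_n = 1 + Σ g_n(ℓ)`).
* §2 ★ `classGroupPRank_cyclotomic_two_eq_sum_of_sq_eq_neg` — **`rank₂ Cl(K_n) = Σ_{ℓ ∣ d} 2^{min(n, ord₂(ℓ²−1)−3)}`** for every cyclotomic `ℤ₂`-extension of `K`
  and every `n` (exact decomposition law, tree `ncard_primesOver_layer_eq_two_pow_min_padicValNat`); eventual value `Σ_{ℓ ∣ d} 2^{ord₂(ℓ²−1)−3}`.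
* §3 ★★ `ferreroKidaSum_le_classicalLambda_add_one_of_mod_four_eq_one` — **`μ₂ = 0` and `Σ − 1 ≤ classicalLambda κ ≤ Σ`**,
  `Σ = Σ_{p ∈ primeFactors d ∖ {2}} 2^{v₂(p²−1)−3}`, for every cyclotomic `ℤ₂`-extension `κ` of `K ∋ √−d`, `d ≡ 1 (mod 4)` squarefree, `d ≠ 1` — the
  named fact `ferreroKida_classicalLambda_two_imaginaryQuadratic` (value `λ + 1 = Σ`) on this half up to the last unit: the lower bound is this lineage's
  capitulation-kernel growth estimate, the upper bound the tree's `λ ≤ rank₂ Cl(K_m)` (`m ≫ 0`).  (Ferrero 1980 / Kida 1979: `λ + 1 = Σ`; the missing unit is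
  Fukuda's unipotence argument run on the `2`-primary quotient `A_n/⟨[𝔓_n]⟩`, whose eventual rank is `Σ − 1`.)

References: [Ferrero1980AJM] §§2–3; [Kida1979Tohoku] Thm. 1; [Schettler2014] Thm. 2, Thm. 8, Rem. 9; [Okazaki2000] §3 Lemma 17; [Washington1997] §13.1, §13.3.
-/

set_option autoImplicit false

noncomputable section

open scoped NumberField
open NumberField NumberField.IsCMField IsDedekindDomain Field IntermediateField Module Ideal

namespace Literature.NumberTheory.IwasawaTheory

open Literature.NumberTheory.EllipticCurves Literature.NumberTheory.EllipticCurves.ZpExtension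
  Literature.NumberTheory.GaloisRepresentations Literature.NumberTheory.NumberFields

/-! ## §1 The `2`-torsion count in `X_n = e(K)·ℚ_n` -/

section Genus

/-- Two rational primes under the same prime ideal are equal. [folklore] -/
private theorem eq_of_liesOver_span' {R : Type*} [CommRing R] (P : Ideal R) {p q : ℕ} (hP : P.LiesOver (Ideal.span {(p : ℤ)}))
    (hQ : P.LiesOver (Ideal.span {(q : ℤ)})) : p = q := by
  have h : Ideal.span {(p : ℤ)} = Ideal.span {(q : ℤ)} := hP.over.trans hQ.over.symm
  have ha : Associated (p : ℤ) (q : ℤ) := Ideal.span_singleton_eq_span_singleton.mp h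
  simpa using Int.associated_iff_natAbs.mp ha

variable {κ : ZpExtension ℚ 2} (hκ : κ.IsCyclotomic) (K : Type) [Field K] [NumberField K] (j : K →ₐ[ℚ] AlgebraicClosure ℚ) (n : ℕ)

include hκ in
/-- **Exact genus count for `X_n = j(K)·ℚ_n`, `K ∋ √−d`, `d ≡ 1 (mod 4)` squarefree** (given the dyadic prime of `X_n`: unique, `e = 2^{n+1}` over `2`): the primes
of `X_n⁺` ramified in `X_n` are the dyadic one and those above the prime factors of `d`, hence **`#Cl(X_n)[2] = 2^{Σ_{ℓ ∣ d} #{primes of ℚ_n above ℓ}`**.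
[cite: Okazaki2000, §3 Lemma 17] [cite: Ferrero1980AJM, §2] [cite: Kida1979Tohoku, Thm. 1 (proof)] [cite: Washington1997, §13.1] -/
theorem natCard_twoTorsion_classGroup_fieldRange_sup_layer_eq_of (hK2 : Module.finrank ℚ K = 2) {d : ℕ} (hsf : Squarefree d) (hd4 : d % 4 = 1)
    (hη : ∃ η : K, η ^ 2 = -((d : ℕ) : K))
    (hdy : haveI : NumberField ↥(j.fieldRange ⊔ κ.layer n) := numberField_fieldRange_sup_layer κ K j n
      ∃ 𝔓 : HeightOneSpectrum (𝓞 ↥(j.fieldRange ⊔ κ.layer n)), (2 : 𝓞 ↥(j.fieldRange ⊔ κ.layer n)) ∈ 𝔓.asIdeal ∧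
        𝔓.asIdeal.ramificationIdx ℤ = 2 ^ (n + 1) ∧ ∀ Q : HeightOneSpectrum (𝓞 ↥(j.fieldRange ⊔ κ.layer n)), (2 : 𝓞 ↥(j.fieldRange ⊔ κ.layer n)) ∈ Q.asIdeal → Q = 𝔓) :
    haveI : NumberField ↥(j.fieldRange ⊔ κ.layer n) := numberField_fieldRange_sup_layer κ K j n
    haveI : NumberField ↥(κ.layer n) := (haveI : FiniteDimensional ℚ ↥(κ.layer n) := κ.finiteDimensional_layer_holds n; NumberField.of_module_finite ℚ _)
    Nat.card {c : ClassGroup (𝓞 ↥(j.fieldRange ⊔ κ.layer n)) // c ^ 2 = 1} =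
      2 ^ (∑ ℓ ∈ d.primeFactors, ((Ideal.span {(ℓ : ℤ)}).primesOver (𝓞 ↥(κ.layer n))).ncard) := by
  classical
  haveI : FiniteDimensional ℚ ↥(κ.layer n) := κ.finiteDimensional_layer_holds n
  haveI : NumberField ↥(κ.layer n) := NumberField.of_module_finite ℚ _
  haveI : NumberField ↥(j.fieldRange ⊔ κ.layer n) := numberField_fieldRange_sup_layer κ K j n
  have hd0 : 0 < d := by omega
  have hIQ := isImaginaryQuadratic_of_sq_eq_neg K hK2 hd0 hη
  obtain ⟨hCM, hdegF, hrest⟩ := isCMField_fieldRange_sup_layer hκ K hIQ j n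
  haveI := hCM
  obtain ⟨hoddF, hsqF, hdisc0, hgen⟩ := hrest
  -- Okazaki's count
  rw [IsCMField.card_twoTorsion_classGroup_eq_two_pow_of_odd_of_forall_isSquare _ hoddF hsqF]
  congr 1
  -- the objects
  set Fp := maximalRealSubfield ↥(j.fieldRange ⊔ κ.layer n) with hFp
  set P := d.primeFactors with hP
  haveI : Module.Free ℚ K := Module.Free.of_divisionRing _ _
  haveI : Algebra.IsQuadraticExtension ℚ K := { finrank_eq_two' := hK2 }
  haveI : IsGalois ℚ K := Algebra.IsQuadraticExtension.isGalois ℚ K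
  haveI : IsGaloisGroup (↥(j.fieldRange ⊔ κ.layer n) ≃ₐ[↥Fp] ↥(j.fieldRange ⊔ κ.layer n)) (𝓞 ↥Fp) (𝓞 ↥(j.fieldRange ⊔ κ.layer n)) :=
    IsGaloisGroup.of_isFractionRing _ _ _ (↥Fp) ↥(j.fieldRange ⊔ κ.layer n)
  -- the `K`-algebra structure through `j`
  let eK : K →+* ↥(j.fieldRange ⊔ κ.layer n) :=
    (j : K →+* AlgebraicClosure ℚ).codRestrict (j.fieldRange ⊔ κ.layer n) fun x =>
      (le_sup_left : j.fieldRange ≤ j.fieldRange ⊔ κ.layer n) (j.mem_fieldRange.mpr ⟨x, rfl⟩)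
  letI algK : Algebra K ↥(j.fieldRange ⊔ κ.layer n) := eK.toAlgebra
  -- prime factors of `d` are odd primes dividing `d_K = -4d`
  have hdisc : NumberField.discr K = -(4 * (d : ℤ)) := discr_eq_neg_four_mul_of_sq_eq_neg K hK2 hsf (Or.inl hd4) hη
  have hPodd : ∀ ℓ ∈ P, ℓ.Prime ∧ ℓ ≠ 2 := by
    intro ℓ hℓ
    refine ⟨Nat.prime_of_mem_primeFactors hℓ, fun h2 => ?_⟩
    rw [h2] at hℓ
    have := Nat.dvd_of_mem_primeFactors hℓ
    omega
  have hPdvd : ∀ ℓ ∈ P, (ℓ : ℤ) ∣ NumberField.discr K := fun ℓ hℓ => by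
    rw [hdisc]
    exact (Int.natCast_dvd_natCast.mpr (Nat.dvd_of_mem_primeFactors hℓ)).mul_left 4 |>.neg_right
  have hdF : ∀ ℓ ∈ P, ¬ (ℓ : ℤ) ∣ NumberField.discr ↥Fp := fun ℓ hℓ => hdisc0 ℓ (hPodd ℓ hℓ).1 (hPodd ℓ hℓ).2
  -- the dyadic prime of `X_n⁺`
  obtain ⟨𝔓, h2𝔓, he𝔓, huniq⟩ := hdy
  obtain ⟨he𝔓p, -⟩ := @dyadic_of_isCMField ↥(j.fieldRange ⊔ κ.layer n) _ _ _ hoddF n hdegF 𝔓 h2𝔓 he𝔓 huniq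
  set 𝔭 : HeightOneSpectrum (𝓞 ↥Fp) := 𝔓.under (𝓞 ↥Fp) with h𝔭
  haveI := 𝔓.isPrime
  haveI := 𝔭.isPrime
  haveI : 𝔓.asIdeal.LiesOver 𝔭.asIdeal := ⟨rfl⟩
  haveI : (Ideal.span {(2 : ℤ)}).IsMaximal := ((Ideal.span_singleton_prime two_ne_zero).mpr Int.prime_two).isMaximal (by simp)
  haveI h𝔓2 : 𝔓.asIdeal.LiesOver (Ideal.span {(2 : ℤ)}) := by
    rw [Ideal.liesOver_span_iff 𝔓.isPrime.ne_top Int.prime_two, map_ofNat]; exact h2𝔓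
  haveI h𝔭2 : 𝔭.asIdeal.LiesOver (Ideal.span {((2 : ℕ) : ℤ)}) := Ideal.LiesOver.tower_bot 𝔓.asIdeal 𝔭.asIdeal _
  have h𝔭ram : 𝔭.asIdeal.ramificationIdxIn (𝓞 ↥(j.fieldRange ⊔ κ.layer n)) ≠ 1 := by
    rw [Ideal.ramificationIdxIn_eq_ramificationIdx 𝔭.asIdeal 𝔓.asIdeal (↥(j.fieldRange ⊔ κ.layer n) ≃ₐ[↥Fp] ↥(j.fieldRange ⊔ κ.layer n)), he𝔓p]
    norm_num
  -- a prime of `X_n⁺` over `2` is `𝔭`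
  have huniq𝔭 : ∀ v : HeightOneSpectrum (𝓞 ↥Fp), v.asIdeal.LiesOver (Ideal.span {((2 : ℕ) : ℤ)}) → v = 𝔭 := by
    intro v hv
    haveI := v.isMaximal
    have h2v : (2 : 𝓞 ↥Fp) ∈ v.asIdeal := by
      have h := Ideal.mem_span_singleton_self ((2 : ℕ) : ℤ)
      rw [hv.over, Ideal.under_def, Ideal.mem_comap, map_natCast] at h
      exact_mod_cast h
    obtain ⟨Q, hQmax, hQover⟩ := Ideal.exists_maximal_ideal_liesOver_of_isIntegral (S := 𝓞 ↥(j.fieldRange ⊔ κ.layer n)) v.asIdeal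
    set QQ : HeightOneSpectrum (𝓞 ↥(j.fieldRange ⊔ κ.layer n)) := ⟨Q, hQmax.isPrime, Ideal.ne_bot_of_liesOver_of_ne_bot v.ne_bot Q⟩
    have h2Q : (2 : 𝓞 ↥(j.fieldRange ⊔ κ.layer n)) ∈ QQ.asIdeal := by
      have : algebraMap (𝓞 ↥Fp) (𝓞 ↥(j.fieldRange ⊔ κ.layer n)) 2 ∈ Q := by
        rw [← Ideal.mem_comap, ← Ideal.under_def, ← hQover.over]; exact h2v
      rwa [map_ofNat] at this
    have hQQ := huniq QQ h2Q
    apply HeightOneSpectrum.ext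
    have : v.asIdeal = QQ.asIdeal.under (𝓞 ↥Fp) := hQover.over
    rw [this, hQQ]
    rfl
  -- (⊆) ramified primes: the dyadic one, or above a prime factor of `d`
  set U := ⋃ ℓ ∈ (P : Set ℕ), {v : HeightOneSpectrum (𝓞 ↥Fp) | v.asIdeal ∈ (Ideal.span {(ℓ : ℤ)}).primesOver (𝓞 ↥Fp)} with hU
  have hcover : {v : HeightOneSpectrum (𝓞 ↥Fp) | v.asIdeal.ramificationIdxIn (𝓞 ↥(j.fieldRange ⊔ κ.layer n)) ≠ 1} ⊆ insert 𝔭 U := by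
    intro v hv
    obtain ⟨q, hq, hqd, hvq⟩ := exists_dvd_discr_of_ramificationIdxIn_ne_one ↥(j.fieldRange ⊔ κ.layer n) K hgen v hv
    by_cases hq2 : q = 2
    · subst hq2
      exact Set.mem_insert_iff.mpr (Or.inl (huniq𝔭 v hvq))
    · refine Set.mem_insert_of_mem _ (Set.mem_biUnion (x := q) ?_ ⟨v.isPrime, hvq⟩)
      rw [hdisc] at hqd
      have hqd' : (q : ℤ) ∣ 4 * (d : ℤ) := (dvd_neg.mp hqd)
      have hq4d : q ∣ 4 * d := by exact_mod_cast hqd'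
      have hqd'' : q ∣ d := by
        rcases (Nat.Prime.dvd_mul hq).mp hq4d with h4 | h4
        · exfalso
          have : q ∣ 2 ^ 2 := by simpa using h4
          exact hq2 ((Nat.prime_dvd_prime_iff_eq hq Nat.prime_two).mp (hq.dvd_of_dvd_pow this))
        · exact h4
      exact Finset.mem_coe.mpr (Nat.mem_primeFactors.mpr ⟨hq, hqd'', by omega⟩)
  -- (⊇)
  have hconv : ∀ ℓ ∈ P, ∀ v : HeightOneSpectrum (𝓞 ↥Fp), v.asIdeal ∈ (Ideal.span {(ℓ : ℤ)}).primesOver (𝓞 ↥Fp) →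
      v.asIdeal.ramificationIdxIn (𝓞 ↥(j.fieldRange ⊔ κ.layer n)) ≠ 1 := fun ℓ hℓP v hv =>
    ramificationIdxIn_ne_one_of_dvd_discr ↥(j.fieldRange ⊔ κ.layer n) K (hPodd ℓ hℓP).1 (hPdvd ℓ hℓP) (hdF ℓ hℓP) v hv
  have hReq : {v : HeightOneSpectrum (𝓞 ↥Fp) | v.asIdeal.ramificationIdxIn (𝓞 ↥(j.fieldRange ⊔ κ.layer n)) ≠ 1} = insert 𝔭 U := by
    refine Set.Subset.antisymm hcover ?_
    intro v hv
    rcases Set.mem_insert_iff.mp hv with rfl | hv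
    · exact h𝔭ram
    · obtain ⟨ℓ, hℓ, hv⟩ := Set.mem_iUnion₂.mp hv
      exact hconv ℓ (Finset.mem_coe.mp hℓ) v hv
  -- counting `U`: `ℚ_n ≅ X_n⁺`
  haveI : IsTotallyReal ↥(κ.layer n) := isTotallyReal_layer_rat κ n
  have hle : κ.layer n ≤ j.fieldRange ⊔ κ.layer n := le_sup_right
  letI algL : Algebra ↥(κ.layer n) ↥(j.fieldRange ⊔ κ.layer n) := (IntermediateField.inclusion hle).toRingHom.toAlgebra
  haveI : Module.Free ↥(κ.layer n) ↥(j.fieldRange ⊔ κ.layer n) := Module.Free.of_divisionRing _ _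
  haveI : Algebra.IsQuadraticExtension ↥(κ.layer n) ↥(j.fieldRange ⊔ κ.layer n) := by
    refine { finrank_eq_two' := ?_ }
    have h1 := finrank_inclusion_mul_finrank (κ.layer n) (j.fieldRange ⊔ κ.layer n) hle
    rw [κ.finrank_layer_holds n] at h1
    have h1' : Module.finrank ↥(κ.layer n) ↥(j.fieldRange ⊔ κ.layer n) * 2 ^ n = 2 ^ n * 2 :=
      h1.trans (by convert hdegF using 2; exact congrArg _ (Subsingleton.elim _ _))
    exact Nat.eq_of_mul_eq_mul_right (pow_pos two_pos n) (h1'.trans (mul_comm _ _))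
  let e := CMExtension.equivMaximalRealSubfield ↥(κ.layer n) ↥(j.fieldRange ⊔ κ.layer n)
  have hfinS : ∀ ℓ ∈ P, ({v : HeightOneSpectrum (𝓞 ↥Fp) | v.asIdeal ∈ (Ideal.span {(ℓ : ℤ)}).primesOver (𝓞 ↥Fp)}).Finite ∧
      ({v : HeightOneSpectrum (𝓞 ↥Fp) | v.asIdeal ∈ (Ideal.span {(ℓ : ℤ)}).primesOver (𝓞 ↥Fp)}).ncard =
        ((Ideal.span {(ℓ : ℤ)}).primesOver (𝓞 ↥(κ.layer n))).ncard := fun ℓ hℓ => by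
    obtain ⟨h1, h2⟩ := finite_and_ncard_setOf_asIdeal_mem_primesOver ↥Fp (hPodd ℓ hℓ).1
    exact ⟨h1, by rw [h2, ← ncard_primesOver_eq_of_ringEquiv e ℓ]⟩
  have hdisj : (P : Set ℕ).PairwiseDisjoint
      (fun ℓ => {v : HeightOneSpectrum (𝓞 ↥Fp) | v.asIdeal ∈ (Ideal.span {(ℓ : ℤ)}).primesOver (𝓞 ↥Fp)}) := by
    intro ℓ hℓ ℓ' hℓ' hne
    refine Set.disjoint_left.mpr fun v hv hv' => hne ?_
    haveI := v.isPrime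
    exact eq_of_liesOver_span' v.asIdeal hv.2 hv'.2
  have hUfin : U.Finite := Set.Finite.biUnion P.finite_toSet fun ℓ hℓ => (hfinS ℓ (Finset.mem_coe.mp hℓ)).1
  have hUcount : U.ncard = ∑ ℓ ∈ P, ((Ideal.span {(ℓ : ℤ)}).primesOver (𝓞 ↥(κ.layer n))).ncard := by
    rw [hU, Set.Finite.ncard_biUnion P.finite_toSet (fun ℓ hℓ => (hfinS ℓ (Finset.mem_coe.mp hℓ)).1) hdisj, finsum_mem_coe_finset]
    exact Finset.sum_congr rfl fun ℓ hℓ => (hfinS ℓ hℓ).2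
  -- `𝔭 ∉ U`
  have h𝔭U : 𝔭 ∉ U := by
    intro h
    obtain ⟨ℓ, hℓ, hv⟩ := Set.mem_iUnion₂.mp h
    have hℓP := Finset.mem_coe.mp hℓ
    have := eq_of_liesOver_span' 𝔭.asIdeal h𝔭2 hv.2
    exact (hPodd ℓ hℓP).2 this.symm
  rw [hReq, Set.ncard_insert_of_notMem h𝔭U hUfin, hUcount]
  simp

include hκ in
/-- **The count for `X_n = e(K)·ℚ_n`, `e = absEmbedding ℚ K`** (dyadic prime from `exists_dyadic_prime_fieldRange_sup_layer`): `#Cl(X_n)[2] = 2^{Σ_{ℓ ∣ d} g_n(ℓ)}`.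
[cite: Okazaki2000, §3 Lemma 17] [cite: Ferrero1980AJM, §2] -/
theorem natCard_twoTorsion_classGroup_fieldRange_sup_layer_eq_of_sq_eq_neg (hK2 : Module.finrank ℚ K = 2) {d : ℕ} (hsf : Squarefree d)
    (hd4 : d % 4 = 1) (hη : ∃ η : K, η ^ 2 = -((d : ℕ) : K)) :
    haveI : NumberField ↥((absEmbedding ℚ K).fieldRange ⊔ κ.layer n) := numberField_fieldRange_sup_layer κ K (absEmbedding ℚ K) n
    haveI : NumberField ↥(κ.layer n) := (haveI : FiniteDimensional ℚ ↥(κ.layer n) := κ.finiteDimensional_layer_holds n; NumberField.of_module_finite ℚ _)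
    Nat.card {c : ClassGroup (𝓞 ↥((absEmbedding ℚ K).fieldRange ⊔ κ.layer n)) // c ^ 2 = 1} =
      2 ^ (∑ ℓ ∈ d.primeFactors, ((Ideal.span {(ℓ : ℤ)}).primesOver (𝓞 ↥(κ.layer n))).ncard) :=
  natCard_twoTorsion_classGroup_fieldRange_sup_layer_eq_of hκ K (absEmbedding ℚ K) n hK2 hsf hd4 hη
    (exists_dyadic_prime_fieldRange_sup_layer hκ K hK2 hd4 hη n)

end Genus

/-! ## §2 `rank₂ Cl(K_n) = Σ_{ℓ ∣ d} 2^{min(n, ord₂(ℓ²−1)−3)}` -/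

section Rank

variable (K : Type) [Field K] [NumberField K]

/-- ★ **`rank₂ Cl(K_n) = Σ_{ℓ ∣ d} 2^{min(n, ord₂(ℓ²−1)−3)}`** for every cyclotomic `ℤ₂`-extension `κK` of `K ∋ √−d` (`[K : ℚ] = 2`, `d ≡ 1 (mod 4)` squarefree) and every `n`:
the layer `K_n ≅ e(K)·ℚ_n`, `#Cl[2] = 2^{rank₂}`, §1, and the exact decomposition law `g_n(ℓ) = 2^{min(n, ord₂(ℓ²−1)−3)}` (tree). [cite: Ferrero1980AJM, §2] [cite: Kida1979Tohoku, Thm. 1]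
[cite: Washington1997, §13.1] -/
theorem classGroupPRank_cyclotomic_two_eq_sum_of_sq_eq_neg (hK2 : Module.finrank ℚ K = 2) {d : ℕ} (hsf : Squarefree d) (hd4 : d % 4 = 1)
    (hη : ∃ η : K, η ^ 2 = -((d : ℕ) : K)) (κK : ZpExtension K 2) (hκK : κK.IsCyclotomic) (n : ℕ) :
    classGroupPRank κK n = ∑ ℓ ∈ d.primeFactors, 2 ^ min n (padicValNat 2 (ℓ ^ 2 - 1) - 3) := by
  haveI : Fact (Nat.Prime 2) := ⟨Nat.prime_two⟩
  set κ := CyclotomicZp.zpExtension 2 with hκdef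
  have hcyc : κ.IsCyclotomic := CyclotomicZp.isCyclotomic_zpExtension 2
  haveI : FiniteDimensional ℚ ↥(κ.layer n) := κ.finiteDimensional_layer_holds n
  haveI : NumberField ↥(κ.layer n) := NumberField.of_module_finite ℚ _
  haveI : NumberField ↥((absEmbedding ℚ K).fieldRange ⊔ κ.layer n) := numberField_fieldRange_sup_layer κ K (absEmbedding ℚ K) n
  have hIQ := isImaginaryQuadratic_of_sq_eq_neg K hK2 (by omega) hη
  have hsurj := surjective_comp_absGaloisRestrict_imaginaryQuadratic_two hcyc K hIQ
  have hκ₀c : (κ.restrict K hsurj).IsCyclotomic := isCyclotomic_restrict κ hcyc K hsurj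
  rw [CoatesSujatha2005.classGroupPRank_eq_of_isCyclotomic κK (κ.restrict K hsurj) hκK hκ₀c]
  obtain ⟨eF⟩ := nonempty_algEquiv_layer_restrict_fieldRange_sup_layer κ K hsurj (absEmbedding ℚ K) n
  have h1 := natCard_torsion_classGroup_layer_eq (κ.restrict K hsurj) n
  have h2 := natCard_twoTorsion_classGroup_eq_of_ringEquiv eF.toRingEquiv
  have h3 := natCard_twoTorsion_classGroup_fieldRange_sup_layer_eq_of_sq_eq_neg hcyc K n hK2 hsf hd4 hη
  have hsum : (∑ ℓ ∈ d.primeFactors, ((Ideal.span {(ℓ : ℤ)}).primesOver (𝓞 ↥(κ.layer n))).ncard) =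
      ∑ ℓ ∈ d.primeFactors, 2 ^ min n (padicValNat 2 (ℓ ^ 2 - 1) - 3) := by
    refine Finset.sum_congr rfl fun ℓ hℓ => ?_
    have hℓp : ℓ.Prime := Nat.prime_of_mem_primeFactors hℓ
    have hℓ2 : ℓ ≠ 2 := fun h => by
      rw [h] at hℓ; have := Nat.dvd_of_mem_primeFactors hℓ; omega
    exact ncard_primesOver_layer_eq_two_pow_min_padicValNat hcyc hℓp hℓ2 n
  refine Nat.pow_right_injective (le_refl 2) ?_
  simp only
  rw [← h1, h2, h3, hsum]

/-- **Stationary value: for `n ≥ n₀` (`ord₂(ℓ²−1) − 3 ≤ n₀` for all `ℓ ∣ d`), `rank₂ Cl(K_n) = Σ_{ℓ ∣ d} 2^{ord₂(ℓ²−1)−3} = Σ_{p ∈ primeFactors d ∖ {2}} 2^{v₂(p²−1)−3}`.**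
[cite: Ferrero1980AJM, §2] [cite: Kida1979Tohoku, Thm. 1] -/
theorem classGroupPRank_cyclotomic_two_eq_ferreroKidaSum_of_sq_eq_neg (hK2 : Module.finrank ℚ K = 2) {d : ℕ} (hsf : Squarefree d) (hd4 : d % 4 = 1)
    (hη : ∃ η : K, η ^ 2 = -((d : ℕ) : K)) (κK : ZpExtension K 2) (hκK : κK.IsCyclotomic)
    {n₀ n : ℕ} (hn₀ : ∀ ℓ ∈ d.primeFactors, padicValNat 2 (ℓ ^ 2 - 1) - 3 ≤ n₀) (hn : n₀ ≤ n) :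
    classGroupPRank κK n = ∑ p ∈ d.primeFactors.erase 2, 2 ^ (padicValNat 2 (p ^ 2 - 1) - 3) := by
  have h2 : 2 ∉ d.primeFactors := fun h => by
    have := Nat.dvd_of_mem_primeFactors h; omega
  rw [Finset.erase_eq_of_notMem h2, classGroupPRank_cyclotomic_two_eq_sum_of_sq_eq_neg K hK2 hsf hd4 hη κK hκK n]
  exact Finset.sum_congr rfl fun ℓ hℓ => by rw [min_eq_right ((hn₀ ℓ hℓ).trans hn)]

end Rank

/-! ## §3 Ferrero–Kida for `d ≡ 1 (mod 4)`, up to one -/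

section Final

variable (K : Type) [Field K] [NumberField K]

/-- ★★ **`Σ − 1 ≤ λ₂(ℚ(√−d)) ≤ Σ` for `d ≡ 1 (mod 4)`.**  `[K : ℚ] = 2`, `K ∋ η` with `η² = −d`, `d ≡ 1 (mod 4)` squarefree, `d ≠ 1`; for EVERY cyclotomic `ℤ₂`-extension `κ`
of `K`: `μ = 0` (growth form), **`Σ ≤ classicalLambda κ + 1`** and **`classicalLambda κ ≤ Σ`**, where `Σ = Σ_{p ∈ primeFactors d ∖ {2}} 2^{v₂(p²−1)−3}` is the
Ferrero–Kida sum of the named fact `ferreroKida_classicalLambda_two_imaginaryQuadratic` (which asserts `λ + 1 = Σ`).  Lower bound: the capitulation kernel of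
`Cl(K_n) → Cl(K_{n+1})` has order `≤ 2` (this lineage), so `e_{n+1} − e_n ≥ rank₂ Cl(K_n) − 1 = Σ − 1` eventually; upper bound: the tree's `λ ≤ rank₂ Cl(K_m)`.
[cite: Ferrero1980AJM, Thm.] [cite: Kida1979Tohoku, Thm. 1] [cite: Schettler2014, Thm. 2 and Rem. 9] [cite: Washington1997, §13.3 Thm. 13.13] -/
theorem ferreroKidaSum_le_classicalLambda_add_one_of_mod_four_eq_one (hK2 : Module.finrank ℚ K = 2) {d : ℕ} (hsf : Squarefree d) (hd4 : d % 4 = 1)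
    (hd1 : d ≠ 1) (hη : ∃ η : K, η ^ 2 = -((d : ℕ) : K)) (κ : ZpExtension K 2) (hκ : κ.IsCyclotomic) :
    ClassicalMuVanishes κ ∧
      (∑ p ∈ d.primeFactors.erase 2, 2 ^ (padicValNat 2 (p ^ 2 - 1) - 3)) ≤ classicalLambda κ + 1 ∧
      classicalLambda κ ≤ ∑ p ∈ d.primeFactors.erase 2, 2 ^ (padicValNat 2 (p ^ 2 - 1) - 3) := by
  classical
  haveI : Fact (Nat.Prime 2) := ⟨Nat.prime_two⟩
  obtain ⟨hμ, m₁, hm₁⟩ := exists_forall_classGroupPRank_le_classicalLambda_add_one K hK2 hsf hd4 hd1 hη κ hκ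
  obtain ⟨m₂, hm₂⟩ := exists_forall_classicalLambda_le_classGroupPRank κ
  set n₀ := d.primeFactors.sup (fun ℓ => padicValNat 2 (ℓ ^ 2 - 1) - 3) with hn₀
  have hn₀' : ∀ ℓ ∈ d.primeFactors, padicValNat 2 (ℓ ^ 2 - 1) - 3 ≤ n₀ := fun ℓ hℓ =>
    Finset.le_sup (f := fun ℓ => padicValNat 2 (ℓ ^ 2 - 1) - 3) hℓ
  set m := max (max m₁ m₂) n₀ with hm
  have hr := classGroupPRank_cyclotomic_two_eq_ferreroKidaSum_of_sq_eq_neg K hK2 hsf hd4 hη κ hκ hn₀' (le_max_right _ _ : n₀ ≤ m)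
  refine ⟨hμ, ?_, ?_⟩
  · rw [← hr]; exact hm₁ m ((le_max_left _ _).trans (le_max_left _ _))
  · rw [← hr]; exact hm₂ m ((le_max_right _ _).trans (le_max_left _ _))

end Final

end Literature.NumberTheory.IwasawaTheory

end
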